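import Summits.QuantumFields.QCD.Theses.HeatSlicedQuarks
import Summits.QuantumFields.QCD.Theorems.HeatSlicedQuarksSmallFieldUltracontractivity
import Summits.QuantumFields.QCD.Theorems.HeatSlicedQuarksSmallFieldUltracontractivityStubRowDuhamel
import Summits.QuantumFields.QCD.Theorems.HeatSlicedQuarksInterleavedHeatSliceFlowStubDuhamelEntrywise
import Summits.QuantumFields.QCD.Theorems.HeatSlicedQuarksInterleavedHeatSliceFlowStubColumnIdentificationAux
import Summits.QuantumFields.QCD.Theorems.HeatSlicedQuarksInterleavedHeatSliceFlowStubColumnIdentificationAuxB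

/-!
# Stub `stub_columnIdentification` of line `Sketch` (crux `InterleavedHeatSliceFlow`, item stmt-QuantumFields-8891)

**Column identification** (reshape r4, the lead's stub): in a gauge with the linear link-deficit profile
`3 − Re tr W(z,μ) ≤ C_A (d(x,z)+1)² δ²` centred at `x` (`δ = ε/r²`) and global `(ε/r²)²`-smallness of the plaquettes,
the column of the heat kernel `K_W(s) = e^{-s D_Wᴴ D_W}` at `(x,a,α)` is the FREE one up to `C δ` in `ℓ²`, uniformly
in `0 ≤ s ≤ r²/2`:  `‖(K_W(s) − K_1(s)) e_{(x,a,α)}‖₂ ≤ C ε/r²`.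

## Proof (the LINEAR law; no log loss)

Column Duhamel (`stub_duhamelEntrywise`): `(K_W(s) − K_1(s)) e = −∫₀ˢ K_W(s−τ) (H_W − H_1) K_1(τ) e dτ` with the
vertex `H_W − H_1 = D_Wᴴ E + Eᴴ D_1`, `E = D_W − D_1`.  Minkowski for columns (8871's
`sqrt_sum_norm_sq_le_integral_of_forall_le`).  The three analytic inputs (hypotheses, other workers' stubs) give
`‖E K_1(τ)e‖₂ ≤ δA₁(1+τ)^{-1/2}`, `‖EᴴD_1K_1(τ)e‖₂ ≤ δA₁(1+τ)⁻¹`, `‖EᴴD_1K_1(τ)e‖₁ ≤ δA₂`.  The `D_Wᴴ E` vertex is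
paid by the merged adjoint-smoothing profile `‖K_W(σ)D_Wᴴ‖ ≤ 9√2/√(1+162eσ)` (`combined_smoothing`); the
`Eᴴ D_1` vertex by the contraction (late half `τ ≥ s/2`) and by `ℓ¹ → ℓ²` ultracontractivity
`‖K_W(σ)‖_{1→2} ≤ √C₈₈₇₁/(2σ)` (T*T + the closed crux 8871 at every site; early half `τ ≤ s/2`, `s ≥ 2`).
All time integrals are then `s`-uniform (`early_smoothing_const_le`, `late_smoothing_const_le`,
`integral_inv_sqrt_one_add_le`, `integral_inv_sqrt_one_add_mul_le`).
-/

noncomputable section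

namespace Summit.QuantumFields.QCD.Cruxes.InterleavedHeatSliceFlow.Sketch

open Literature.MathematicalPhysics.QuantumLattice Literature.MathematicalPhysics.QuantumFieldTheory
  Literature.Probability.LatticeModels
open Summit.QuantumFields.QCD.Theses.HeatSlicedQuarks
open Summit.QuantumFields.QCD.Theorems.SmallFieldUltracontractivity.Negative
open Summit.QuantumFields.QCD.Cruxes.SmallFieldUltracontractivity.PointCentredAxialParabolic
open MeasureTheory intervalIntegral
open scoped Matrix ComplexConjugate

/-- Entries of a triple matrix product as an iterated `mulVec` of a column. -/
theorem mul_mul_apply_eq_mulVec {ι : Type} [Fintype ι] (A B C : Matrix ι ι ℂ) (i j : ι) :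
    (A * B * C) i j = A.mulVec (B.mulVec fun k => C k j) i := by
  rw [Matrix.mul_assoc]
  simp only [Matrix.mul_apply, Matrix.mulVec, dotProduct]

/-- Entries of a matrix product as `mulVec` of a column. -/
theorem mul_apply_eq_mulVec {ι : Type} [Fintype ι] (A C : Matrix ι ι ℂ) (i j : ι) :
    (A * C) i j = A.mulVec (fun k => C k j) i := by
  simp only [Matrix.mul_apply, Matrix.mulVec, dotProduct]

/-- The vertex identity `AᴴA − BᴴB = Aᴴ(A − B) + (A − B)ᴴ B`. -/
theorem conjTranspose_mul_self_sub_eq {ι : Type} [Fintype ι] (A B : Matrix ι ι ℂ) :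
    Aᴴ * A - Bᴴ * B = Aᴴ * (A - B) + (A - B)ᴴ * B := by
  rw [Matrix.conjTranspose_sub, Matrix.mul_sub, Matrix.sub_mul]
  abel

/-- `√(a² x / y) = a √x / √y` for `a ≥ 0`, `y ≥ 0`. -/
theorem sqrt_sq_mul_div {a x y : ℝ} (ha : 0 ≤ a) (hy : 0 ≤ y) :
    Real.sqrt (a ^ 2 * x / y) = a * Real.sqrt x / Real.sqrt y := by
  rw [Real.sqrt_div' _ hy, Real.sqrt_mul (sq_nonneg a), Real.sqrt_sq ha]

set_option maxHeartbeats 1600000 in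
/-- **Stub `stub_columnIdentification`** (L; lead c2; reshape r4):
`HoppingWeightedBounds → FreeColumnProfile → FreeWeightedMoments → ColumnIdentification`, all written out. -/
theorem stub_columnIdentification :
    (∀ C_A : ℝ, 0 ≤ C_A → ∃ C : ℝ, ∀ (L : ℕ) [NeZero L]
      (W : GaugeConfig 4 L (Matrix.specialUnitaryGroup (Fin 3) ℂ)) (m : ℝ) (x : TorusSite 4 L) (δ : ℝ), 0 ≤ δ →
      (∀ (z : TorusSite 4 L) (μ : Fin 4),
        3 - ((fundamentalRep (Fin 3)) (W (z, μ))).trace.re ≤ C_A * ((torusDist x z : ℝ) + 1) ^ 2 * δ ^ 2) →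
      ∀ v : TorusSite 4 L × Fin 3 × Fin 4 → ℂ,
        (∑ q, ‖((wilsonDirac (fundamentalRep (Fin 3)) W m 1 -
            wilsonDirac (fundamentalRep (Fin 3))
              (fun _ : Edge 4 L => (1 : Matrix.specialUnitaryGroup (Fin 3) ℂ)) m 1).mulVec v) q‖ ^ 2 ≤
          C * δ ^ 2 * ∑ q, ((torusDist x q.1 : ℝ) + 3) ^ 2 * ‖v q‖ ^ 2) ∧
        (∑ q, ‖((wilsonDirac (fundamentalRep (Fin 3)) W m 1 -
            wilsonDirac (fundamentalRep (Fin 3))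
              (fun _ : Edge 4 L => (1 : Matrix.specialUnitaryGroup (Fin 3) ℂ)) m 1)ᴴ.mulVec v) q‖ ^ 2 ≤
          C * δ ^ 2 * ∑ q, ((torusDist x q.1 : ℝ) + 3) ^ 2 * ‖v q‖ ^ 2) ∧
        (∑ q, ‖((wilsonDirac (fundamentalRep (Fin 3)) W m 1 -
            wilsonDirac (fundamentalRep (Fin 3))
              (fun _ : Edge 4 L => (1 : Matrix.specialUnitaryGroup (Fin 3) ℂ)) m 1)ᴴ.mulVec v) q‖ ≤
          C * δ * ∑ q, ((torusDist x q.1 : ℝ) + 3) * ‖v q‖)) →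
    (∃ C c : ℝ, 0 < c ∧ ∀ (L : ℕ) [NeZero L] (m : ℝ), m ∈ Set.Icc (-(1 / 2 : ℝ)) 1 →
      ∀ σ : ℝ, 0 ≤ σ → σ ≤ (L : ℝ) ^ 2 → ∀ (x z : TorusSite 4 L) (a b : Fin 3) (α β : Fin 4),
        ‖(NormedSpace.exp (-(σ : ℂ) •
            ((wilsonDirac (fundamentalRep (Fin 3))
                (fun _ : Edge 4 L => (1 : Matrix.specialUnitaryGroup (Fin 3) ℂ)) m 1)ᴴ *
              wilsonDirac (fundamentalRep (Fin 3))
                (fun _ : Edge 4 L => (1 : Matrix.specialUnitaryGroup (Fin 3) ℂ)) m 1))) (z, b, β) (x, a, α)‖ ≤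
            C * Real.exp (-(c * σ * m ^ 2)) * (1 + σ) / (1 + σ + (torusDist x z : ℝ) ^ 2) ^ 3 ∧
        ‖(wilsonDirac (fundamentalRep (Fin 3))
              (fun _ : Edge 4 L => (1 : Matrix.specialUnitaryGroup (Fin 3) ℂ)) m 1 *
            NormedSpace.exp (-(σ : ℂ) •
              ((wilsonDirac (fundamentalRep (Fin 3))
                  (fun _ : Edge 4 L => (1 : Matrix.specialUnitaryGroup (Fin 3) ℂ)) m 1)ᴴ *
                wilsonDirac (fundamentalRep (Fin 3))
                  (fun _ : Edge 4 L => (1 : Matrix.specialUnitaryGroup (Fin 3) ℂ)) m 1))) (z, b, β) (x, a, α)‖ ≤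
            C * Real.exp (-(c * σ * m ^ 2)) * Real.sqrt (1 + σ) / (1 + σ + (torusDist x z : ℝ) ^ 2) ^ 3) →
    (∃ M : ℝ, ∀ (L : ℕ) [NeZero L] (x : TorusSite 4 L) (σ : ℝ), 0 ≤ σ →
      (∑ z : TorusSite 4 L, ((torusDist x z : ℝ) + 3) ^ 2 *
          ((1 + σ) / (1 + σ + (torusDist x z : ℝ) ^ 2) ^ 3) ^ 2 ≤ M / (1 + σ)) ∧
      (∑ z : TorusSite 4 L, ((torusDist x z : ℝ) + 3) ^ 2 *
          (Real.sqrt (1 + σ) / (1 + σ + (torusDist x z : ℝ) ^ 2) ^ 3) ^ 2 ≤ M / (1 + σ) ^ 2) ∧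
      (∑ z : TorusSite 4 L, ((torusDist x z : ℝ) + 3) *
          (Real.sqrt (1 + σ) / (1 + σ + (torusDist x z : ℝ) ^ 2) ^ 3) ≤ M)) →
    (∀ C_A : ℝ, 0 ≤ C_A → ∃ ε₀ : ℝ, 0 < ε₀ ∧ ∃ C : ℝ, ∀ (L : ℕ) [NeZero L]
      (W : GaugeConfig 4 L (Matrix.specialUnitaryGroup (Fin 3) ℂ)) (m : ℝ), m ∈ Set.Icc (-(1 / 2 : ℝ)) 1 →
      ∀ (r : ℕ), 1 ≤ r → r ≤ L → ∀ (ε : ℝ), 0 < ε → ε ≤ ε₀ →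
      (∀ (y : TorusSite 4 L) (μ ν : Fin 4),
        3 - ((fundamentalRep (Fin 3)) (plaquetteHolonomy W y μ ν)).trace.re ≤ (ε / (r : ℝ) ^ 2) ^ 2) →
      ∀ (x : TorusSite 4 L),
      (∀ (z : TorusSite 4 L) (μ : Fin 4),
        3 - ((fundamentalRep (Fin 3)) (W (z, μ))).trace.re ≤
          C_A * ((torusDist x z : ℝ) + 1) ^ 2 * (ε / (r : ℝ) ^ 2) ^ 2) →
      ∀ (s : ℝ), 0 ≤ s → 2 * s ≤ (r : ℝ) ^ 2 → ∀ (a : Fin 3) (α : Fin 4),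
        Real.sqrt (∑ q, ‖(NormedSpace.exp (-(s : ℂ) • ((wilsonDirac (fundamentalRep (Fin 3)) W m 1)ᴴ *
                wilsonDirac (fundamentalRep (Fin 3)) W m 1))) q (x, a, α) -
              (NormedSpace.exp (-(s : ℂ) •
                ((wilsonDirac (fundamentalRep (Fin 3))
                    (fun _ : Edge 4 L => (1 : Matrix.specialUnitaryGroup (Fin 3) ℂ)) m 1)ᴴ *
                  wilsonDirac (fundamentalRep (Fin 3))
                    (fun _ : Edge 4 L => (1 : Matrix.specialUnitaryGroup (Fin 3) ℂ)) m 1))) q (x, a, α)‖ ^ 2) ≤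
          C * (ε / (r : ℝ) ^ 2)) := by
  intro hHop hFree hMom C_A hCA
  obtain ⟨C_H0, hH0⟩ := hHop C_A hCA
  obtain ⟨C_F0, c_F, _hcF, hF0⟩ := hFree
  obtain ⟨M0, hM0⟩ := hMom
  obtain ⟨ε₈, hε₈, K₈, C₈, hSFU⟩ :=
    (Cruxes.SmallFieldUltracontractivity.PointCentredAxialParabolic.SmallFieldUltracontractivity_of :
      SmallFieldUltracontractivity)
  -- nonnegative versions of the constants
  set C_H : ℝ := max C_H0 0 with hCH
  set C_F : ℝ := max C_F0 0 with hCF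
  set M : ℝ := max M0 0 with hMdef
  have hCH0 : 0 ≤ C_H := le_max_right _ _
  have hCF0 : 0 ≤ C_F := le_max_right _ _
  have hM00 : 0 ≤ M := le_max_right _ _
  set A₁ : ℝ := Real.sqrt (C_H * (12 * C_F ^ 2 * M)) with hA₁
  set A₂ : ℝ := C_H * (12 * C_F * M) with hA₂
  have hA₁0 : 0 ≤ A₁ := Real.sqrt_nonneg _
  have hA₂0 : 0 ≤ A₂ := by positivity
  refine ⟨min ε₈ 1, lt_min hε₈ one_pos, 40 * A₁ + Real.sqrt C₈ * A₂, ?_⟩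
  intro L _ W m hm r hr hrL ε hε hεle hsmall x hprof s hs0 hsr a α
  -- notation
  set D : Matrix (TorusSite 4 L × Fin 3 × Fin 4) (TorusSite 4 L × Fin 3 × Fin 4) ℂ :=
    wilsonDirac (fundamentalRep (Fin 3)) W m 1 with hD
  set D₁ : Matrix (TorusSite 4 L × Fin 3 × Fin 4) (TorusSite 4 L × Fin 3 × Fin 4) ℂ :=
    wilsonDirac (fundamentalRep (Fin 3)) (fun _ : Edge 4 L => (1 : Matrix.specialUnitaryGroup (Fin 3) ℂ)) m 1
    with hD₁
  set p₀ : TorusSite 4 L × Fin 3 × Fin 4 := (x, a, α) with hp₀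
  set δ : ℝ := ε / (r : ℝ) ^ 2 with hδ
  have hr0 : (0 : ℝ) < (r : ℝ) := by exact_mod_cast (Nat.lt_of_lt_of_le Nat.zero_lt_one hr)
  have hr2 : (0 : ℝ) < (r : ℝ) ^ 2 := by positivity
  have hδ0 : 0 ≤ δ := div_nonneg hε.le hr2.le
  have hεε₈ : ε ≤ ε₈ := hεle.trans (min_le_left _ _)
  have hL1 : (1 : ℝ) ≤ (L : ℝ) := by exact_mod_cast hr.trans hrL
  have hrL' : (r : ℝ) ≤ (L : ℝ) := by exact_mod_cast hrL
  have hsL : s ≤ (L : ℝ) ^ 2 := by nlinarith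
  -- the kernels as functions of time
  let K : ℝ → Matrix _ _ ℂ := fun σ => NormedSpace.exp (-(σ : ℂ) • (Dᴴ * D))
  let K₁ : ℝ → Matrix _ _ ℂ := fun τ => NormedSpace.exp (-(τ : ℂ) • (D₁ᴴ * D₁))
  let col : ℝ → (TorusSite 4 L × Fin 3 × Fin 4) → ℂ := fun τ q => K₁ τ q p₀
  /- ───── 1. free column profiles and their weighted moments ───── -/
  have hprofile : ∀ τ, 0 ≤ τ → τ ≤ s → ∀ z b β,
      ‖col τ (z, b, β)‖ ≤ C_F * ((1 + τ) / (1 + τ + (torusDist x z : ℝ) ^ 2) ^ 3) ∧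
      ‖(D₁.mulVec (col τ)) (z, b, β)‖ ≤ C_F * (Real.sqrt (1 + τ) / (1 + τ + (torusDist x z : ℝ) ^ 2) ^ 3) := by
    intro τ hτ0 hτs z b β
    have h := hF0 L m hm τ hτ0 (hτs.trans hsL) x z a b α β
    have hexp : Real.exp (-(c_F * τ * m ^ 2)) ≤ 1 := by
      rw [Real.exp_le_one_iff]
      have : 0 ≤ c_F * τ * m ^ 2 := by have := _hcF.le; positivity
      linarith
    have hden : 0 < (1 + τ + (torusDist x z : ℝ) ^ 2) ^ 3 := by positivity
    have hCF' : C_F0 ≤ C_F := le_max_left _ _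
    constructor
    · refine h.1.trans ?_
      rw [mul_div_assoc]
      calc C_F0 * Real.exp (-(c_F * τ * m ^ 2)) * ((1 + τ) / (1 + τ + (torusDist x z : ℝ) ^ 2) ^ 3)
          ≤ C_F * 1 * ((1 + τ) / (1 + τ + (torusDist x z : ℝ) ^ 2) ^ 3) := by
            have hq : 0 ≤ (1 + τ) / (1 + τ + (torusDist x z : ℝ) ^ 2) ^ 3 := by positivity
            have h1 : C_F0 * Real.exp (-(c_F * τ * m ^ 2)) ≤ C_F * 1 := by
              rcases le_or_gt 0 C_F0 with hc | hc
              · exact mul_le_mul hCF' hexp (Real.exp_pos _).le hCF0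
              · exact (mul_nonpos_of_nonpos_of_nonneg hc.le (Real.exp_pos _).le |>.trans (by positivity))
            exact mul_le_mul_of_nonneg_right h1 hq
        _ = _ := by rw [mul_one]
    · have hmv : (D₁.mulVec (col τ)) (z, b, β) = (D₁ * K₁ τ) (z, b, β) p₀ := (mul_apply_eq_mulVec D₁ (K₁ τ) _ _).symm
      rw [hmv]
      refine h.2.trans ?_
      rw [mul_div_assoc]
      have hq : 0 ≤ Real.sqrt (1 + τ) / (1 + τ + (torusDist x z : ℝ) ^ 2) ^ 3 := by positivity
      calc C_F0 * Real.exp (-(c_F * τ * m ^ 2)) * (Real.sqrt (1 + τ) / (1 + τ + (torusDist x z : ℝ) ^ 2) ^ 3)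
          ≤ C_F * 1 * (Real.sqrt (1 + τ) / (1 + τ + (torusDist x z : ℝ) ^ 2) ^ 3) := by
            have h1 : C_F0 * Real.exp (-(c_F * τ * m ^ 2)) ≤ C_F * 1 := by
              rcases le_or_gt 0 C_F0 with hc | hc
              · exact mul_le_mul hCF' hexp (Real.exp_pos _).le hCF0
              · exact (mul_nonpos_of_nonpos_of_nonneg hc.le (Real.exp_pos _).le |>.trans (by positivity))
            exact mul_le_mul_of_nonneg_right h1 hq
        _ = _ := by rw [mul_one]
  have hw0 : ∀ z : TorusSite 4 L, 0 ≤ ((torusDist x z : ℝ) + 3) ^ 2 := fun z => by positivity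
  have hw1 : ∀ z : TorusSite 4 L, 0 ≤ ((torusDist x z : ℝ) + 3) := fun z => by positivity
  have hmomA : ∀ τ, 0 ≤ τ → τ ≤ s →
      ∑ q : TorusSite 4 L × Fin 3 × Fin 4, ((torusDist x q.1 : ℝ) + 3) ^ 2 * ‖col τ q‖ ^ 2 ≤
        12 * C_F ^ 2 * (M / (1 + τ)) := by
    intro τ hτ0 hτs
    refine (sum_weight_norm_sq_le_of_profile (col τ) (fun z => ((torusDist x z : ℝ) + 3) ^ 2)
      (fun z => (1 + τ) / (1 + τ + (torusDist x z : ℝ) ^ 2) ^ 3) hw0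
      (fun z b β => (hprofile τ hτ0 hτs z b β).1)).trans ?_
    refine mul_le_mul_of_nonneg_left (((hM0 L x τ hτ0).1).trans ?_) (by positivity)
    exact div_le_div_of_nonneg_right (le_max_left _ _) (by linarith)
  have hmomB : ∀ τ, 0 ≤ τ → τ ≤ s →
      ∑ q : TorusSite 4 L × Fin 3 × Fin 4, ((torusDist x q.1 : ℝ) + 3) ^ 2 * ‖(D₁.mulVec (col τ)) q‖ ^ 2 ≤
        12 * C_F ^ 2 * (M / (1 + τ) ^ 2) := by
    intro τ hτ0 hτs
    refine (sum_weight_norm_sq_le_of_profile (D₁.mulVec (col τ)) (fun z => ((torusDist x z : ℝ) + 3) ^ 2)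
      (fun z => Real.sqrt (1 + τ) / (1 + τ + (torusDist x z : ℝ) ^ 2) ^ 3) hw0
      (fun z b β => (hprofile τ hτ0 hτs z b β).2)).trans ?_
    refine mul_le_mul_of_nonneg_left (((hM0 L x τ hτ0).2.1).trans ?_) (by positivity)
    exact div_le_div_of_nonneg_right (le_max_left _ _) (by positivity)
  have hmomC : ∀ τ, 0 ≤ τ → τ ≤ s →
      ∑ q : TorusSite 4 L × Fin 3 × Fin 4, ((torusDist x q.1 : ℝ) + 3) * ‖(D₁.mulVec (col τ)) q‖ ≤
        12 * C_F * M := by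
    intro τ hτ0 hτs
    refine (sum_weight_norm_le_of_profile (D₁.mulVec (col τ)) (fun z => ((torusDist x z : ℝ) + 3))
      (fun z => Real.sqrt (1 + τ) / (1 + τ + (torusDist x z : ℝ) ^ 2) ^ 3) hw1
      (fun z b β => (hprofile τ hτ0 hτs z b β).2)).trans ?_
    exact mul_le_mul_of_nonneg_left (((hM0 L x τ hτ0).2.2).trans (le_max_left _ _)) (by positivity)
  /- ───── 2. the vertex bounds ───── -/
  have hHop' := hH0 L W m x δ hδ0 (fun z μ => by rw [hδ]; exact hprof z μ)
  have hE1 : ∀ τ, 0 ≤ τ → τ ≤ s →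
      Real.sqrt (∑ q, ‖((D - D₁).mulVec (col τ)) q‖ ^ 2) ≤ δ * A₁ / Real.sqrt (1 + τ) := by
    intro τ hτ0 hτs
    have h1 := (hHop' (col τ)).1
    have h2 : C_H0 * δ ^ 2 * ∑ q, ((torusDist x q.1 : ℝ) + 3) ^ 2 * ‖col τ q‖ ^ 2 ≤
        C_H * δ ^ 2 * (12 * C_F ^ 2 * (M / (1 + τ))) := by
      have hS0 : 0 ≤ ∑ q : TorusSite 4 L × Fin 3 × Fin 4, ((torusDist x q.1 : ℝ) + 3) ^ 2 * ‖col τ q‖ ^ 2 :=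
        Finset.sum_nonneg fun q _ => by positivity
      calc C_H0 * δ ^ 2 * ∑ q, ((torusDist x q.1 : ℝ) + 3) ^ 2 * ‖col τ q‖ ^ 2
          ≤ C_H * δ ^ 2 * ∑ q, ((torusDist x q.1 : ℝ) + 3) ^ 2 * ‖col τ q‖ ^ 2 :=
            mul_le_mul_of_nonneg_right (mul_le_mul_of_nonneg_right (le_max_left _ _) (sq_nonneg _)) hS0
        _ ≤ C_H * δ ^ 2 * (12 * C_F ^ 2 * (M / (1 + τ))) :=
            mul_le_mul_of_nonneg_left (hmomA τ hτ0 hτs) (by positivity)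
    have h3 : C_H * δ ^ 2 * (12 * C_F ^ 2 * (M / (1 + τ))) = δ ^ 2 * (C_H * (12 * C_F ^ 2 * M)) / (1 + τ) := by
      ring
    calc Real.sqrt (∑ q, ‖((D - D₁).mulVec (col τ)) q‖ ^ 2)
        ≤ Real.sqrt (δ ^ 2 * (C_H * (12 * C_F ^ 2 * M)) / (1 + τ)) := Real.sqrt_le_sqrt (by rw [← h3]; exact h1.trans h2)
      _ = δ * A₁ / Real.sqrt (1 + τ) := by rw [sqrt_sq_mul_div hδ0 (by linarith)]
  have hE2 : ∀ τ, 0 ≤ τ → τ ≤ s →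
      Real.sqrt (∑ q, ‖((D - D₁)ᴴ.mulVec (D₁.mulVec (col τ))) q‖ ^ 2) ≤ δ * A₁ / (1 + τ) := by
    intro τ hτ0 hτs
    have h1 := (hHop' (D₁.mulVec (col τ))).2.1
    have h2 : C_H0 * δ ^ 2 * ∑ q, ((torusDist x q.1 : ℝ) + 3) ^ 2 * ‖(D₁.mulVec (col τ)) q‖ ^ 2 ≤
        C_H * δ ^ 2 * (12 * C_F ^ 2 * (M / (1 + τ) ^ 2)) := by
      have hS0 : 0 ≤ ∑ q : TorusSite 4 L × Fin 3 × Fin 4,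
          ((torusDist x q.1 : ℝ) + 3) ^ 2 * ‖(D₁.mulVec (col τ)) q‖ ^ 2 :=
        Finset.sum_nonneg fun q _ => by positivity
      calc C_H0 * δ ^ 2 * ∑ q, ((torusDist x q.1 : ℝ) + 3) ^ 2 * ‖(D₁.mulVec (col τ)) q‖ ^ 2
          ≤ C_H * δ ^ 2 * ∑ q, ((torusDist x q.1 : ℝ) + 3) ^ 2 * ‖(D₁.mulVec (col τ)) q‖ ^ 2 :=
            mul_le_mul_of_nonneg_right (mul_le_mul_of_nonneg_right (le_max_left _ _) (sq_nonneg _)) hS0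
        _ ≤ C_H * δ ^ 2 * (12 * C_F ^ 2 * (M / (1 + τ) ^ 2)) :=
            mul_le_mul_of_nonneg_left (hmomB τ hτ0 hτs) (by positivity)
    have h3 : C_H * δ ^ 2 * (12 * C_F ^ 2 * (M / (1 + τ) ^ 2)) =
        δ ^ 2 * (C_H * (12 * C_F ^ 2 * M)) / (1 + τ) ^ 2 := by ring
    have h1τ : 0 ≤ 1 + τ := by linarith
    calc Real.sqrt (∑ q, ‖((D - D₁)ᴴ.mulVec (D₁.mulVec (col τ))) q‖ ^ 2)
        ≤ Real.sqrt (δ ^ 2 * (C_H * (12 * C_F ^ 2 * M)) / (1 + τ) ^ 2) :=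
          Real.sqrt_le_sqrt (by rw [← h3]; exact h1.trans h2)
      _ = δ * A₁ / (1 + τ) := by rw [sqrt_sq_mul_div hδ0 (by positivity), Real.sqrt_sq h1τ]
  have hE3 : ∀ τ, 0 ≤ τ → τ ≤ s →
      ∑ q, ‖((D - D₁)ᴴ.mulVec (D₁.mulVec (col τ))) q‖ ≤ δ * A₂ := by
    intro τ hτ0 hτs
    have h1 := (hHop' (D₁.mulVec (col τ))).2.2
    have hS0 : 0 ≤ ∑ q : TorusSite 4 L × Fin 3 × Fin 4,
        ((torusDist x q.1 : ℝ) + 3) * ‖(D₁.mulVec (col τ)) q‖ := Finset.sum_nonneg fun q _ => by positivity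
    calc ∑ q, ‖((D - D₁)ᴴ.mulVec (D₁.mulVec (col τ))) q‖
        ≤ C_H0 * δ * ∑ q, ((torusDist x q.1 : ℝ) + 3) * ‖(D₁.mulVec (col τ)) q‖ := h1
      _ ≤ C_H * δ * ∑ q, ((torusDist x q.1 : ℝ) + 3) * ‖(D₁.mulVec (col τ)) q‖ :=
          mul_le_mul_of_nonneg_right (mul_le_mul_of_nonneg_right (le_max_left _ _) hδ0) hS0
      _ ≤ C_H * δ * (12 * C_F * M) := mul_le_mul_of_nonneg_left (hmomC τ hτ0 hτs) (by positivity)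
      _ = δ * A₂ := by rw [hA₂]; ring
  /- ───── 3. the Duhamel integrand and its pointwise bounds ───── -/
  let F : ℝ → (TorusSite 4 L × Fin 3 × Fin 4) → ℂ := fun τ q =>
    -((K (s - τ) * (Dᴴ * D - D₁ᴴ * D₁) * K₁ τ) q p₀)
  have hFrepr : ∀ τ q, F τ q =
      -(((K (s - τ) * Dᴴ).mulVec ((D - D₁).mulVec (col τ)) q) +
        (K (s - τ)).mulVec ((D - D₁)ᴴ.mulVec (D₁.mulVec (col τ))) q) := by
    intro τ q
    show -((K (s - τ) * (Dᴴ * D - D₁ᴴ * D₁) * K₁ τ) q p₀) = _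
    rw [mul_mul_apply_eq_mulVec, conjTranspose_mul_self_sub_eq, Matrix.add_mulVec, Matrix.mulVec_add,
      ← Matrix.mulVec_mulVec, ← Matrix.mulVec_mulVec, ← Matrix.mulVec_mulVec, Pi.add_apply]
  -- the merged smoothing profile
  let φ : ℝ → ℝ := fun σ => 9 * Real.sqrt 2 / Real.sqrt (1 + 162 * Real.exp 1 * σ)
  have hφ0 : ∀ σ, 0 ≤ σ → 0 ≤ φ σ := fun σ _ => by positivity
  have hφle : ∀ σ, 0 ≤ σ → φ σ ≤ 9 * Real.sqrt 2 := fun σ hσ => by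
    show 9 * Real.sqrt 2 / Real.sqrt (1 + 162 * Real.exp 1 * σ) ≤ 9 * Real.sqrt 2
    refine div_le_self (by positivity) ?_
    exact Real.one_le_sqrt.mpr (by nlinarith [Real.exp_pos 1])
  -- pointwise bound with the contraction on the second vertex
  have hpt1 : ∀ τ, 0 ≤ τ → τ ≤ s →
      Real.sqrt (∑ q, ‖F τ q‖ ^ 2) ≤ φ (s - τ) * (δ * A₁ / Real.sqrt (1 + τ)) + δ * A₁ / (1 + τ) := by
    intro τ hτ0 hτs
    have hστ : 0 ≤ s - τ := by linarith
    have heq : (fun q => F τ q) = fun q => ((fun q => -(((K (s - τ) * Dᴴ).mulVec ((D - D₁).mulVec (col τ)) q)))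
        q + (fun q => -((K (s - τ)).mulVec ((D - D₁)ᴴ.mulVec (D₁.mulVec (col τ))) q)) q) := by
      funext q; rw [hFrepr]; ring
    have hnorm : ∑ q, ‖F τ q‖ ^ 2 = ∑ q, ‖(fun q => -(((K (s - τ) * Dᴴ).mulVec ((D - D₁).mulVec (col τ)) q)))
        q + (fun q => -((K (s - τ)).mulVec ((D - D₁)ᴴ.mulVec (D₁.mulVec (col τ))) q)) q‖ ^ 2 := by
      simp only [heq]
    rw [hnorm]
    refine (sqrt_sum_norm_sq_add_le _ _).trans (add_le_add ?_ ?_)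
    · simp only [norm_neg]
      refine (combined_smoothing W hm hστ _).trans ?_
      exact mul_le_mul_of_nonneg_left (hE1 τ hτ0 hτs) (hφ0 _ hστ)
    · simp only [norm_neg]
      calc Real.sqrt (∑ q, ‖(K (s - τ)).mulVec ((D - D₁)ᴴ.mulVec (D₁.mulVec (col τ))) q‖ ^ 2)
          ≤ Real.sqrt (∑ q, ‖((D - D₁)ᴴ.mulVec (D₁.mulVec (col τ))) q‖ ^ 2) :=
            Real.sqrt_le_sqrt (heat_mulVec_contraction D hστ _)
        _ ≤ δ * A₁ / (1 + τ) := hE2 τ hτ0 hτs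
  -- the column sup of the interacting kernel from the closed crux 8871 (T*T)
  have hcolsup : ∀ σ, 1 ≤ 2 * σ → 2 * σ ≤ (r : ℝ) ^ 2 → ∀ q,
      Real.sqrt (∑ i, ‖K σ i q‖ ^ 2) ≤ Real.sqrt C₈ / (2 * σ) := by
    intro σ h1 h2 q
    have hσ0 : 0 < σ := by linarith
    have hTT := sum_norm_sq_col_eq_re_apply_self D σ q
    obtain ⟨y, b, β⟩ := q
    have hsfu := hSFU L W m hm y r hr hrL (fun y' _ μ ν => (hsmall y' μ ν).trans (by
      have h1' : 0 ≤ ε / (r : ℝ) ^ 2 := div_nonneg hε.le hr2.le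
      exact pow_le_pow_left₀ h1' (div_le_div_of_nonneg_right hεε₈ hr2.le) 2)) (2 * σ) h1 h2 b b β β
    have hre : ((NormedSpace.exp (-((2 * σ : ℝ) : ℂ) • (Dᴴ * D))) (y, b, β) (y, b, β)).re ≤ C₈ / (2 * σ) ^ 2 :=
      (Complex.re_le_norm _).trans (by exact_mod_cast hsfu)
    calc Real.sqrt (∑ i, ‖K σ i (y, b, β)‖ ^ 2) ≤ Real.sqrt (C₈ / (2 * σ) ^ 2) :=
          Real.sqrt_le_sqrt (by rw [show (∑ i, ‖K σ i (y, b, β)‖ ^ 2) = _ from hTT]; exact hre)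
      _ = Real.sqrt C₈ / (2 * σ) := by rw [Real.sqrt_div' _ (sq_nonneg _), Real.sqrt_sq (by linarith)]
  -- pointwise bound with ultracontractivity on the second vertex (early half, `s ≥ 2`)
  have hpt2 : 2 ≤ s → ∀ τ, 0 ≤ τ → τ ≤ s / 2 →
      Real.sqrt (∑ q, ‖F τ q‖ ^ 2) ≤ φ (s - τ) * (δ * A₁ / Real.sqrt (1 + τ)) + Real.sqrt C₈ / s * (δ * A₂) := by
    intro hs2 τ hτ0 hτs
    have hστ : 0 ≤ s - τ := by linarith
    have hτs' : τ ≤ s := by linarith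
    have heq : (fun q => F τ q) = fun q => ((fun q => -(((K (s - τ) * Dᴴ).mulVec ((D - D₁).mulVec (col τ)) q)))
        q + (fun q => -((K (s - τ)).mulVec ((D - D₁)ᴴ.mulVec (D₁.mulVec (col τ))) q)) q) := by
      funext q; rw [hFrepr]; ring
    have hnorm : ∑ q, ‖F τ q‖ ^ 2 = ∑ q, ‖(fun q => -(((K (s - τ) * Dᴴ).mulVec ((D - D₁).mulVec (col τ)) q)))
        q + (fun q => -((K (s - τ)).mulVec ((D - D₁)ᴴ.mulVec (D₁.mulVec (col τ))) q)) q‖ ^ 2 := by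
      simp only [heq]
    rw [hnorm]
    refine (sqrt_sum_norm_sq_add_le _ _).trans (add_le_add ?_ ?_)
    · simp only [norm_neg]
      refine (combined_smoothing W hm hστ _).trans ?_
      exact mul_le_mul_of_nonneg_left (hE1 τ hτ0 hτs') (hφ0 _ hστ)
    · simp only [norm_neg]
      have hS := hcolsup (s - τ) (by linarith) (by linarith)
      have hsq0 : 0 ≤ Real.sqrt C₈ / (2 * (s - τ)) := div_nonneg (Real.sqrt_nonneg _) (by linarith)
      calc Real.sqrt (∑ q, ‖(K (s - τ)).mulVec ((D - D₁)ᴴ.mulVec (D₁.mulVec (col τ))) q‖ ^ 2)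
          ≤ Real.sqrt C₈ / (2 * (s - τ)) * ∑ q, ‖((D - D₁)ᴴ.mulVec (D₁.mulVec (col τ))) q‖ :=
            sqrt_sum_norm_sq_mulVec_le_of_col_le _ hS _
        _ ≤ Real.sqrt C₈ / (2 * (s - τ)) * (δ * A₂) := mul_le_mul_of_nonneg_left (hE3 τ hτ0 hτs') hsq0
        _ ≤ Real.sqrt C₈ / s * (δ * A₂) := by
            refine mul_le_mul_of_nonneg_right ?_ (by positivity)
            exact div_le_div_of_nonneg_left (Real.sqrt_nonneg _) (by linarith) (by linarith)
  /- ───── 4. Duhamel, continuity, Minkowski ───── -/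
  have hduh : ∀ q, (K s q p₀ - K₁ s q p₀) = ∫ τ in (0:ℝ)..s, F τ q := by
    intro q
    have h := stub_duhamelEntrywise _ (Dᴴ * D) (D₁ᴴ * D₁) s q p₀
    rw [← intervalIntegral.integral_neg] at h
    rw [← Matrix.sub_apply]
    exact h
  have hFcont : ∀ q, ContinuousOn (fun τ => F τ q) (Set.Icc 0 s) := by
    intro q
    have h := rowDuhamel_continuousOn_entry (Dᴴ * D) (D₁ᴴ * D₁) (1 : Matrix _ _ ℂ) s
      (θ := fun _ => (1 : ℝ)) (θ' := fun _ => (0 : ℝ)) (S := Set.Icc 0 s) continuousOn_const continuousOn_const q p₀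
    refine h.neg.congr fun τ _ => ?_
    show -((NormedSpace.exp (-((s - τ : ℝ) : ℂ) • (Dᴴ * D)) * (Dᴴ * D - D₁ᴴ * D₁) *
        NormedSpace.exp (-(τ : ℂ) • (D₁ᴴ * D₁))) q p₀) = _
    simp only [Matrix.mul_one, Matrix.one_mul, Complex.ofReal_one, Complex.ofReal_zero, one_smul, zero_smul,
      add_zero, Pi.neg_apply]
  /- ───── 5. Minkowski bookkeeping (`column_norm_le_of_pointwise`) ───── -/
  have hpt2' : 2 ≤ s → ∀ τ, 0 ≤ τ → τ ≤ s / 2 →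
      Real.sqrt (∑ q, ‖F τ q‖ ^ 2) ≤ φ (s - τ) * (δ * A₁ / Real.sqrt (1 + τ)) + Real.sqrt C₈ * (δ * A₂) / s := by
    intro hs2 τ hτ0 hτs
    exact (hpt2 hs2 τ hτ0 hτs).trans (le_of_eq (by ring))
  have hkey := column_norm_le_of_pointwise (fun q => K s q p₀ - K₁ s q p₀) F hs0
    (by positivity : 0 ≤ δ * A₁) (by positivity : 0 ≤ Real.sqrt C₈ * (δ * A₂)) hduh hFcont hpt1 hpt2'
  -- back to the statement's vocabulary
  have hfinal : Real.sqrt (∑ q, ‖K s q p₀ - K₁ s q p₀‖ ^ 2) ≤ (40 * A₁ + Real.sqrt C₈ * A₂) * (ε / (r : ℝ) ^ 2) := by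
    rw [← hδ]
    refine hkey.trans (le_of_eq ?_)
    ring
  exact hfinal

end Summit.QuantumFields.QCD.Cruxes.InterleavedHeatSliceFlow.Sketch

end
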